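import Summits.Ventures.PercRepro.S2FourTriangles
import Summits.Ventures.PercRepro.S2FourTriBound

/-!
# PercRepro — S2: THE TOP `5`-SETS AGAINST FOUR TRIANGLES AT `(13, 7)` — THE COUNT `U₅ ≤ 13398` AS A LEMMA (p7, gen 17)

The four-triangle private-part count of the row `t = 4` (`S2ThirteenSevenSpreadFour`, gen 16), stated once for every row with
`≥ 4` triangles: on a core of rank `13` on `20` points whose lines carry `≤ 3` points, four distinct triangles `T₁ … T₄`
(`W = ⋃ Tᵢ`, private parts `Pᵢ = Tᵢ ∖ (the others)`) bound the top `5`-sets by `13398` — a top `5`-set meets the union of any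
three of the triangles, so its trace on `W` lies in no `Pᵢ`; the trace families number `C(20 − w + pᵢ, 5)` with union
`≥ Σ C(20 − w + pᵢ, 5) − 3·C(20 − w, 5)`; the supersets of a triangle outside them are not top sets; a shared point lies on
two triangles (`2·w ≤ 12 + Σ pᵢ`); the worst case (`S2.four_tri_bound`) is four disjoint triangles.
**`ncard_top_five_le_of_four_triangles`**: the body of gen 16's row `t = 4`, verbatim, as a lemma for the rows `t ≥ 5`.
Nothing about any cell is claimed. Axioms: standard.
-/

open scoped Matroid

namespace PercRepro

namespace S2

open Set

variable {α : Type}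

/-- **The top `5`-sets against four distinct triangles at `(13, 7)`**: at most `13398` (the private-part count of gen 16's
row `t = 4`, as a lemma). -/
theorem ncard_top_five_le_of_four_triangles (M : Matroid α) [M.Finite]
    (hR : M.eRank = ((13 : ℕ) : ℕ∞)) (hn : M.E.ncard = 13 + 7)
    (hC1 : ∀ L ⊆ M.E, M.eRk L = 2 → L.ncard ≤ 3)
    {T₁ T₂ T₃ T₄ : Set α}
    (hT₁ : T₁ ∈ {C : Set α | M.IsCircuit C ∧ C.ncard = 3}) (hT₂ : T₂ ∈ {C : Set α | M.IsCircuit C ∧ C.ncard = 3})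
    (hT₃ : T₃ ∈ {C : Set α | M.IsCircuit C ∧ C.ncard = 3}) (hT₄ : T₄ ∈ {C : Set α | M.IsCircuit C ∧ C.ncard = 3})
    (h12 : T₁ ≠ T₂) (h13 : T₁ ≠ T₃) (h14 : T₁ ≠ T₄) (h23 : T₂ ≠ T₃) (h24 : T₂ ≠ T₄) (h34 : T₃ ≠ T₄) :
    {B : Set α | B ⊆ M.E ∧ B.ncard = 5 ∧ M.eRk B = 5 ∧ M.eRk (M.E \ B) = M.eRank}.ncard ≤ 13398 := by
  classical
  have hEfin := M.ground_finite
  have hfinT : ∀ {T : Set α}, M.IsCircuit T → T.Finite := fun hT => hEfin.subset hT.subset_ground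
  have e₁ := hT₁.2
  have e₂ := hT₂.2
  have e₃ := hT₃.2
  have e₄ := hT₄.2
  -- the union `W`, the others `Oᵢ`, the private parts `Pᵢ`
  set W : Set α := T₁ ∪ T₂ ∪ T₃ ∪ T₄ with hWdef
  set O₁ : Set α := T₂ ∪ T₃ ∪ T₄ with hO₁
  set O₂ : Set α := T₁ ∪ T₃ ∪ T₄ with hO₂
  set O₃ : Set α := T₁ ∪ T₂ ∪ T₄ with hO₃
  set O₄ : Set α := T₁ ∪ T₂ ∪ T₃ with hO₄
  set P₁ : Set α := T₁ \ O₁ with hP₁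
  set P₂ : Set α := T₂ \ O₂ with hP₂
  set P₃ : Set α := T₃ \ O₃ with hP₃
  set P₄ : Set α := T₄ \ O₄ with hP₄
  have hW1 : T₁ ∪ O₁ = W := by ext x; simp only [hWdef, hO₁, hO₄, Set.mem_union]; tauto
  have hW2 : T₂ ∪ O₂ = W := by ext x; simp only [hWdef, hO₂, hO₄, Set.mem_union]; tauto
  have hW3 : T₃ ∪ O₃ = W := by ext x; simp only [hWdef, hO₃, hO₄, Set.mem_union]; tauto
  have hW4 : T₄ ∪ O₄ = W := by ext x; simp only [hWdef, hO₄, Set.mem_union]; tauto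
  have hWE : W ⊆ M.E := Set.union_subset (Set.union_subset (Set.union_subset hT₁.1.subset_ground
    hT₂.1.subset_ground) hT₃.1.subset_ground) hT₄.1.subset_ground
  have hWfin : W.Finite := hEfin.subset hWE
  have hT₁W : T₁ ⊆ W := fun x hx => Or.inl (Or.inl (Or.inl hx))
  have hT₂W : T₂ ⊆ W := fun x hx => Or.inl (Or.inl (Or.inr hx))
  have hT₃W : T₃ ⊆ W := fun x hx => Or.inl (Or.inr hx)
  have hT₄W : T₄ ⊆ W := fun x hx => Or.inr hx
  have hP₁T : P₁ ⊆ T₁ := Set.sdiff_subset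
  have hP₂T : P₂ ⊆ T₂ := Set.sdiff_subset
  have hP₃T : P₃ ⊆ T₃ := Set.sdiff_subset
  have hP₄T : P₄ ⊆ T₄ := Set.sdiff_subset
  -- the private parts are pairwise disjoint and avoid the other triangles
  have hPdis : Disjoint P₁ P₂ ∧ Disjoint P₁ P₃ ∧ Disjoint P₁ P₄ ∧ Disjoint P₂ P₃ ∧ Disjoint P₂ P₄ ∧ Disjoint P₃ P₄ := by
    refine ⟨?_, ?_, ?_, ?_, ?_, ?_⟩ <;> rw [Set.disjoint_left] <;> rintro x ⟨hx, hxn⟩ ⟨hy, hyn⟩ <;>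
      simp only [hO₁, hO₂, hO₃, hO₄, Set.mem_union, not_or] at hxn hyn <;> tauto
  obtain ⟨d12, d13, d14, d23, d24, d34⟩ := hPdis
  -- no top `5`-set has its trace inside a private part
  set Top := {B : Set α | B ⊆ M.E ∧ B.ncard = 5 ∧ M.eRk B = 5 ∧ M.eRk (M.E \ B) = M.eRank} with hTop
  have hTopfin : Top.Finite := hEfin.finite_subsets.subset (fun X hX => hX.1)
  have hnot₁ : ∀ B ∈ Top, ¬ (B ∩ W ⊆ P₁) := by
    rintro B ⟨hBE, hB5, -, hBs⟩
    have := S2.top_five_trace_not_subset_private M hR hn hC1 (T := T₁) hT₂.1 hT₂.2 hT₃.1 hT₃.2 hT₄.1 hT₄.2 h23 h24 h34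
      rfl hBE hB5 hBs
    rwa [hW1] at this
  have hnot₂ : ∀ B ∈ Top, ¬ (B ∩ W ⊆ P₂) := by
    rintro B ⟨hBE, hB5, -, hBs⟩
    have := S2.top_five_trace_not_subset_private M hR hn hC1 (T := T₂) hT₁.1 hT₁.2 hT₃.1 hT₃.2 hT₄.1 hT₄.2 h13 h14 h34
      rfl hBE hB5 hBs
    rwa [hW2] at this
  have hnot₃ : ∀ B ∈ Top, ¬ (B ∩ W ⊆ P₃) := by
    rintro B ⟨hBE, hB5, -, hBs⟩
    have := S2.top_five_trace_not_subset_private M hR hn hC1 (T := T₃) hT₁.1 hT₁.2 hT₂.1 hT₂.2 hT₄.1 hT₄.2 h12 h14 h24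
      rfl hBE hB5 hBs
    rwa [hW3] at this
  have hnot₄ : ∀ B ∈ Top, ¬ (B ∩ W ⊆ P₄) := by
    rintro B ⟨hBE, hB5, -, hBs⟩
    have := S2.top_five_trace_not_subset_private M hR hn hC1 (T := T₄) hT₁.1 hT₁.2 hT₂.1 hT₂.2 hT₃.1 hT₃.2 h12 h13 h23
      rfl hBE hB5 hBs
    rwa [hW4] at this
  -- the trace families and their sizes
  let A : Set α → Set (Set α) := fun P => {X : Set α | X ⊆ M.E ∧ X.ncard = 5 ∧ X ∩ W ⊆ P}
  have hAfin : ∀ P, (A P).Finite := fun P => hEfin.finite_subsets.subset (fun X hX => hX.1)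
  have hAcard : ∀ P ⊆ W, (A P).ncard = ((M.E \ W).ncard + P.ncard).choose 5 := by
    intro P hP
    have hPfin : P.Finite := hWfin.subset hP
    have heq : A P = {X : Set α | X ⊆ (M.E \ W) ∪ P ∧ X.ncard = 5} := by
      ext X
      simp only [A, Set.mem_setOf_eq]
      constructor
      · rintro ⟨hXE, hX5, hXP⟩
        exact ⟨(S2.trace_subset_iff hWE hP).1 ⟨hXE, hXP⟩, hX5⟩
      · rintro ⟨hX, hX5⟩
        obtain ⟨hXE, hXP⟩ := (S2.trace_subset_iff hWE hP).2 hX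
        exact ⟨hXE, hX5, hXP⟩
    rw [heq, S2.ncard_subsets_ncard_eq _ ((hEfin.sdiff).union hPfin) 5,
      Set.ncard_union_eq (Set.disjoint_left.2 fun x hx hxP => hx.2 (hP hxP)) (hEfin.sdiff) hPfin]
  have hA₀ : (A ∅).ncard = (M.E \ W).ncard.choose 5 := by
    rw [hAcard ∅ (Set.empty_subset W), Set.ncard_empty, Nat.add_zero]
  have hunion : (A P₁).ncard + (A P₂).ncard + (A P₃).ncard + (A P₄).ncard ≤
      (A P₁ ∪ A P₂ ∪ A P₃ ∪ A P₄).ncard + 3 * (A ∅).ncard :=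
    S2.ncard_union_four_trace_add_le M.E W P₁ P₂ P₃ P₄ hEfin d12 d13 d14 d23 d24 d34
  -- the supersets of a triangle outside the trace families
  let F : Set α → Set α → Set (Set α) := fun T P => {X : Set α | X ⊆ M.E ∧ X.ncard = 5 ∧ T ⊆ X ∧ ¬ (X ∩ W ⊆ P)}
  have hFfin : ∀ T P, (F T P).Finite := fun T P => hEfin.finite_subsets.subset (fun X hX => hX.1)
  have hFlow : ∀ {T P : Set α}, M.IsCircuit T → T.ncard = 3 → P ⊆ T → 136 ≤ (F T P).ncard + (M.E \ W).ncard.choose 2 := by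
    intro T P hT hT3 hP
    have h := S2.ncard_supersets_outside_trace_ge M (W := W) hT.subset_ground hT3 hP
    have e : (M.E \ T).ncard = 17 := by
      have := Set.ncard_sdiff_add_ncard_of_subset hT.subset_ground hEfin
      omega
    rw [e] at h
    norm_num [Nat.choose] at h
    exact h
  -- the three families are disjoint inside the `5`-subsets of `E`
  have hTopF : ∀ {T P : Set α}, M.IsCircuit T → Disjoint Top (F T P) := by
    intro T P hT
    rw [Set.disjoint_left]
    rintro B ⟨hBE, hB5, hBr, -⟩ ⟨-, -, hTB, -⟩
    exact S2.not_subset_of_top_five M hT hBE hB5 hBr hTB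
  have hTopA : Disjoint Top (A P₁ ∪ A P₂ ∪ A P₃ ∪ A P₄) := by
    rw [Set.disjoint_left]
    rintro B hB (((h | h) | h) | h)
    · exact hnot₁ B hB h.2.2
    · exact hnot₂ B hB h.2.2
    · exact hnot₃ B hB h.2.2
    · exact hnot₄ B hB h.2.2
  -- a superset of `Tᵢ` has its trace in no private part
  have hFA : ∀ {T P Q : Set α}, T ⊆ W → T.ncard = 3 → (P = Q ∨ Disjoint T Q) → Disjoint (F T P) (A Q) := by
    intro T P Q hTW hT3 hPQ
    rw [Set.disjoint_left]
    rintro X ⟨hXE, hX5, hTX, hXP⟩ ⟨-, -, hXQ⟩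
    rcases hPQ with rfl | hdis
    · exact hXP hXQ
    · obtain ⟨x, hx⟩ : T.Nonempty := Set.nonempty_of_ncard_ne_zero (by omega)
      exact Set.disjoint_left.1 hdis hx (hXQ ⟨hTX hx, hTW hx⟩)
  have hTdisP : Disjoint T₁ P₂ ∧ Disjoint T₁ P₃ ∧ Disjoint T₁ P₄ ∧ Disjoint T₂ P₁ ∧ Disjoint T₂ P₃ ∧ Disjoint T₂ P₄ ∧
      Disjoint T₃ P₁ ∧ Disjoint T₃ P₂ ∧ Disjoint T₃ P₄ ∧ Disjoint T₄ P₁ ∧ Disjoint T₄ P₂ ∧ Disjoint T₄ P₃ := by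
    refine ⟨?_, ?_, ?_, ?_, ?_, ?_, ?_, ?_, ?_, ?_, ?_, ?_⟩ <;> rw [Set.disjoint_left] <;> rintro x hx ⟨-, hxn⟩ <;>
      simp only [hO₁, hO₂, hO₃, hO₄, Set.mem_union, not_or] at hxn <;> tauto
  obtain ⟨t12, t13, t14, t21, t23, t24, t31, t32, t34, t41, t42, t43⟩ := hTdisP
  have hFAall : Disjoint (F T₁ P₁ ∪ F T₂ P₂ ∪ F T₃ P₃ ∪ F T₄ P₄) (A P₁ ∪ A P₂ ∪ A P₃ ∪ A P₄) := by
    refine Set.disjoint_union_left.2 ⟨Set.disjoint_union_left.2 ⟨Set.disjoint_union_left.2 ⟨?_, ?_⟩, ?_⟩, ?_⟩ <;>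
      refine Set.disjoint_union_right.2 ⟨Set.disjoint_union_right.2 ⟨Set.disjoint_union_right.2 ⟨?_, ?_⟩, ?_⟩, ?_⟩
    · exact hFA hT₁W hT₁.2 (Or.inl rfl)
    · exact hFA hT₁W hT₁.2 (Or.inr t12)
    · exact hFA hT₁W hT₁.2 (Or.inr t13)
    · exact hFA hT₁W hT₁.2 (Or.inr t14)
    · exact hFA hT₂W hT₂.2 (Or.inr t21)
    · exact hFA hT₂W hT₂.2 (Or.inl rfl)
    · exact hFA hT₂W hT₂.2 (Or.inr t23)
    · exact hFA hT₂W hT₂.2 (Or.inr t24)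
    · exact hFA hT₃W hT₃.2 (Or.inr t31)
    · exact hFA hT₃W hT₃.2 (Or.inr t32)
    · exact hFA hT₃W hT₃.2 (Or.inl rfl)
    · exact hFA hT₃W hT₃.2 (Or.inr t34)
    · exact hFA hT₄W hT₄.2 (Or.inr t41)
    · exact hFA hT₄W hT₄.2 (Or.inr t42)
    · exact hFA hT₄W hT₄.2 (Or.inr t43)
    · exact hFA hT₄W hT₄.2 (Or.inl rfl)
  have hTopFall : Disjoint Top (F T₁ P₁ ∪ F T₂ P₂ ∪ F T₃ P₃ ∪ F T₄ P₄) :=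
    Set.disjoint_union_right.2 ⟨Set.disjoint_union_right.2 ⟨Set.disjoint_union_right.2 ⟨hTopF hT₁.1, hTopF hT₂.1⟩,
      hTopF hT₃.1⟩, hTopF hT₄.1⟩
  -- the three disjoint families lie in the `5`-subsets of `E`
  have hGfin : (F T₁ P₁ ∪ F T₂ P₂ ∪ F T₃ P₃ ∪ F T₄ P₄).Finite :=
    (((hFfin _ _).union (hFfin _ _)).union (hFfin _ _)).union (hFfin _ _)
  have hAAfin : (A P₁ ∪ A P₂ ∪ A P₃ ∪ A P₄).Finite :=
    (((hAfin _).union (hAfin _)).union (hAfin _)).union (hAfin _)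
  have htotal : Top.ncard + (F T₁ P₁ ∪ F T₂ P₂ ∪ F T₃ P₃ ∪ F T₄ P₄).ncard + (A P₁ ∪ A P₂ ∪ A P₃ ∪ A P₄).ncard ≤ 15504 := by
    have hsub : Top ∪ (F T₁ P₁ ∪ F T₂ P₂ ∪ F T₃ P₃ ∪ F T₄ P₄) ∪ (A P₁ ∪ A P₂ ∪ A P₃ ∪ A P₄) ⊆
        {X : Set α | X ⊆ M.E ∧ X.ncard = 5} := by
      rintro X ((hX | (((hX | hX) | hX) | hX)) | (((hX | hX) | hX) | hX)) <;> exact ⟨hX.1, hX.2.1⟩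
    have h := Set.ncard_le_ncard hsub (hEfin.finite_subsets.subset (fun X hX => hX.1))
    rw [S2.ncard_subsets_ncard_eq M.E hEfin 5, hn] at h
    norm_num [Nat.choose] at h
    rw [Set.ncard_union_eq (Set.disjoint_union_left.2 ⟨hTopA, hFAall⟩) (hTopfin.union hGfin) hAAfin,
      Set.ncard_union_eq hTopFall hTopfin hGfin] at h
    exact h
  -- the supersets: pairwise at most one common member
  have hFpair : ∀ {T T' P P' : Set α}, M.IsCircuit T → T.ncard = 3 → M.IsCircuit T' → T'.ncard = 3 → T ≠ T' →
      (F T P ∩ F T' P').ncard ≤ 1 := by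
    intro T T' P P' hT hTc hT' hT'c hne
    have hu5 : 5 ≤ (T ∪ T').ncard := S2.five_le_ncard_union_of_triangles M hC1 hT hTc hT' hT'c hne
    have hsub : F T P ∩ F T' P' ⊆ {X : Set α | X ⊆ M.E ∧ X.ncard = 5 ∧ T ∪ T' ⊆ X} := by
      rintro X ⟨hX1, hX2⟩
      exact ⟨hX1.1, hX1.2.1, Set.union_subset hX1.2.2.1 hX2.2.2.1⟩
    have h := S2.ncard_subsets_superset_le M (Set.union_subset hT.subset_ground hT'.subset_ground) 5
    rw [hn] at h
    have hle := Set.ncard_le_ncard hsub (hEfin.finite_subsets.subset (fun X hX => hX.1))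
    have hch : (13 + 7 - (T ∪ T').ncard).choose (5 - (T ∪ T').ncard) ≤ 1 := by
      have h0 : 5 - (T ∪ T').ncard = 0 := by omega
      rw [h0, Nat.choose_zero_right]
    omega
  have hG : (F T₁ P₁).ncard + (F T₂ P₂).ncard + (F T₃ P₃).ncard + (F T₄ P₄).ncard ≤
      (F T₁ P₁ ∪ F T₂ P₂ ∪ F T₃ P₃ ∪ F T₄ P₄).ncard + 6 := by
    have u12 := Set.ncard_union_add_ncard_inter (F T₁ P₁) (F T₂ P₂) (hFfin _ _) (hFfin _ _)
    have u13 := Set.ncard_union_add_ncard_inter (F T₁ P₁ ∪ F T₂ P₂) (F T₃ P₃) ((hFfin _ _).union (hFfin _ _)) (hFfin _ _)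
    have u14 := Set.ncard_union_add_ncard_inter (F T₁ P₁ ∪ F T₂ P₂ ∪ F T₃ P₃) (F T₄ P₄)
      (((hFfin _ _).union (hFfin _ _)).union (hFfin _ _)) (hFfin _ _)
    have i13 : ((F T₁ P₁ ∪ F T₂ P₂) ∩ F T₃ P₃).ncard ≤ (F T₁ P₁ ∩ F T₃ P₃).ncard + (F T₂ P₂ ∩ F T₃ P₃).ncard := by
      rw [Set.union_inter_distrib_right]; exact Set.ncard_union_le _ _
    have i14 : ((F T₁ P₁ ∪ F T₂ P₂ ∪ F T₃ P₃) ∩ F T₄ P₄).ncard ≤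
        (F T₁ P₁ ∩ F T₄ P₄).ncard + (F T₂ P₂ ∩ F T₄ P₄).ncard + (F T₃ P₃ ∩ F T₄ P₄).ncard := by
      rw [Set.union_inter_distrib_right, Set.union_inter_distrib_right]
      exact le_trans (Set.ncard_union_le _ _) (Nat.add_le_add_right (Set.ncard_union_le _ _) _)
    have p12 := hFpair (P := P₁) (P' := P₂) hT₁.1 hT₁.2 hT₂.1 hT₂.2 h12
    have p13 := hFpair (P := P₁) (P' := P₃) hT₁.1 hT₁.2 hT₃.1 hT₃.2 h13
    have p14 := hFpair (P := P₁) (P' := P₄) hT₁.1 hT₁.2 hT₄.1 hT₄.2 h14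
    have p23 := hFpair (P := P₂) (P' := P₃) hT₂.1 hT₂.2 hT₃.1 hT₃.2 h23
    have p24 := hFpair (P := P₂) (P' := P₄) hT₂.1 hT₂.2 hT₄.1 hT₄.2 h24
    have p34 := hFpair (P := P₃) (P' := P₄) hT₃.1 hT₃.2 hT₄.1 hT₄.2 h34
    omega
  have f1 := hFlow hT₁.1 hT₁.2 hP₁T
  have f2 := hFlow hT₂.1 hT₂.2 hP₂T
  have f3 := hFlow hT₃.1 hT₃.2 hP₃T
  have f4 := hFlow hT₄.1 hT₄.2 hP₄T
  -- the geometry: `w`, the `pᵢ`, the shared points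
  have hPW₁ : P₁ ⊆ W := hP₁T.trans hT₁W
  have hPW₂ : P₂ ⊆ W := hP₂T.trans hT₂W
  have hPW₃ : P₃ ⊆ W := hP₃T.trans hT₃W
  have hPW₄ : P₄ ⊆ W := hP₄T.trans hT₄W
  have a1 := hAcard P₁ hPW₁
  have a2 := hAcard P₂ hPW₂
  have a3 := hAcard P₃ hPW₃
  have a4 := hAcard P₄ hPW₄
  have hEW : (M.E \ W).ncard + W.ncard = 20 := by
    have := Set.ncard_sdiff_add_ncard_of_subset hWE hEfin
    omega
  have hw12 : W.ncard ≤ 12 := by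
    have h1 : W.ncard ≤ (T₁ ∪ T₂ ∪ T₃).ncard + T₄.ncard := Set.ncard_union_le _ _
    have h2 := Set.ncard_union_le (T₁ ∪ T₂) T₃
    have h3 := Set.ncard_union_le T₁ T₂
    omega
  have hw5 : 5 ≤ W.ncard := by
    have h := S2.five_le_ncard_union_of_triangles M hC1 hT₁.1 hT₁.2 hT₂.1 hT₂.2 h12
    have := Set.ncard_le_ncard (Set.subset_union_left.trans Set.subset_union_left : T₁ ∪ T₂ ⊆ W) hWfin
    omega
  have hp₁ : P₁.ncard ≤ 3 := by have := Set.ncard_le_ncard hP₁T (hfinT hT₁.1); omega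
  have hp₂ : P₂.ncard ≤ 3 := by have := Set.ncard_le_ncard hP₂T (hfinT hT₂.1); omega
  have hp₃ : P₃.ncard ≤ 3 := by have := Set.ncard_le_ncard hP₃T (hfinT hT₃.1); omega
  have hp₄ : P₄.ncard ≤ 3 := by have := Set.ncard_le_ncard hP₄T (hfinT hT₄.1); omega
  have hPfin : ∀ {P : Set α}, P ⊆ W → P.Finite := fun hP => hWfin.subset hP
  have hsumP : (P₁ ∪ P₂ ∪ P₃ ∪ P₄).ncard = P₁.ncard + P₂.ncard + P₃.ncard + P₄.ncard := by
    rw [Set.ncard_union_eq (Set.disjoint_union_left.2 ⟨Set.disjoint_union_left.2 ⟨d14, d24⟩, d34⟩)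
        (((hPfin hPW₁).union (hPfin hPW₂)).union (hPfin hPW₃)) (hPfin hPW₄),
      Set.ncard_union_eq (Set.disjoint_union_left.2 ⟨d13, d23⟩) ((hPfin hPW₁).union (hPfin hPW₂)) (hPfin hPW₃),
      Set.ncard_union_eq d12 (hPfin hPW₁) (hPfin hPW₂)]
  have hPWsub : P₁ ∪ P₂ ∪ P₃ ∪ P₄ ⊆ W :=
    Set.union_subset (Set.union_subset (Set.union_subset hPW₁ hPW₂) hPW₃) hPW₄
  have hsle : P₁.ncard + P₂.ncard + P₃.ncard + P₄.ncard ≤ W.ncard := by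
    rw [← hsumP]; exact Set.ncard_le_ncard hPWsub hWfin
  -- the shared points `S = W ∖ ⋃ Pᵢ`: each lies on two triangles
  set S : Set α := W \ (P₁ ∪ P₂ ∪ P₃ ∪ P₄) with hSdef
  have hSfin : S.Finite := hWfin.sdiff
  have hScard : S.ncard + (P₁.ncard + P₂.ncard + P₃.ncard + P₄.ncard) = W.ncard := by
    rw [← hsumP]; exact Set.ncard_sdiff_add_ncard_of_subset hPWsub hWfin
  have hai : ∀ {T P : Set α}, P ⊆ T → P ⊆ P₁ ∪ P₂ ∪ P₃ ∪ P₄ → T.ncard = 3 → T.Finite →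
      (T ∩ S).ncard + P.ncard ≤ 3 := by
    intro T P hPT hPU hT3 hTf
    have hdis : Disjoint (T ∩ S) P := by
      rw [Set.disjoint_left]
      rintro x ⟨-, hxS⟩ hxP
      exact hxS.2 (hPU hxP)
    have hsub : (T ∩ S) ∪ P ⊆ T := Set.union_subset Set.inter_subset_left hPT
    have h := Set.ncard_le_ncard hsub hTf
    rw [Set.ncard_union_eq hdis (hTf.inter_of_left _) (hTf.subset hPT), hT3] at h
    exact h
  have hcov : S ⊆ ((T₁ ∩ S) ∩ (T₂ ∩ S)) ∪ ((T₃ ∩ S) ∩ (T₄ ∩ S)) ∪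
      (((T₁ ∩ S) ∪ (T₂ ∩ S)) ∩ ((T₃ ∩ S) ∪ (T₄ ∩ S))) := by
    intro x hx
    have hxS : x ∈ S := hx
    obtain ⟨hxW, hxn⟩ := hx
    have n1 : x ∈ T₁ → x ∈ O₁ := fun h => by_contra (fun h' => hxn (Or.inl (Or.inl (Or.inl ⟨h, h'⟩))))
    have n2 : x ∈ T₂ → x ∈ O₂ := fun h => by_contra (fun h' => hxn (Or.inl (Or.inl (Or.inr ⟨h, h'⟩))))
    have n3 : x ∈ T₃ → x ∈ O₃ := fun h => by_contra (fun h' => hxn (Or.inl (Or.inr ⟨h, h'⟩)))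
    have n4 : x ∈ T₄ → x ∈ O₄ := fun h => by_contra (fun h' => hxn (Or.inr ⟨h, h'⟩))
    have key : (x ∈ T₁ ∧ x ∈ T₂) ∨ (x ∈ T₃ ∧ x ∈ T₄) ∨ ((x ∈ T₁ ∨ x ∈ T₂) ∧ (x ∈ T₃ ∨ x ∈ T₄)) := by
      rcases hxW with ((h1 | h2) | h3) | h4
      · rcases n1 h1 with (h | h) | h
        · exact Or.inl ⟨h1, h⟩
        · exact Or.inr (Or.inr ⟨Or.inl h1, Or.inl h⟩)
        · exact Or.inr (Or.inr ⟨Or.inl h1, Or.inr h⟩)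
      · rcases n2 h2 with (h | h) | h
        · exact Or.inl ⟨h, h2⟩
        · exact Or.inr (Or.inr ⟨Or.inr h2, Or.inl h⟩)
        · exact Or.inr (Or.inr ⟨Or.inr h2, Or.inr h⟩)
      · rcases n3 h3 with (h | h) | h
        · exact Or.inr (Or.inr ⟨Or.inl h, Or.inl h3⟩)
        · exact Or.inr (Or.inr ⟨Or.inr h, Or.inl h3⟩)
        · exact Or.inr (Or.inl ⟨h3, h⟩)
      · rcases n4 h4 with (h | h) | h
        · exact Or.inr (Or.inr ⟨Or.inl h, Or.inr h4⟩)
        · exact Or.inr (Or.inr ⟨Or.inr h, Or.inr h4⟩)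
        · exact Or.inr (Or.inl ⟨h, h4⟩)
    rcases key with ⟨h1, h2⟩ | ⟨h3, h4⟩ | ⟨h12, h34⟩
    · exact Or.inl (Or.inl ⟨⟨h1, hxS⟩, ⟨h2, hxS⟩⟩)
    · exact Or.inl (Or.inr ⟨⟨h3, hxS⟩, ⟨h4, hxS⟩⟩)
    · refine Or.inr ⟨?_, ?_⟩
      · rcases h12 with h | h
        · exact Or.inl ⟨h, hxS⟩
        · exact Or.inr ⟨h, hxS⟩
      · rcases h34 with h | h
        · exact Or.inl ⟨h, hxS⟩
        · exact Or.inr ⟨h, hxS⟩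
  have hdc := S2.two_mul_ncard_le_sum_of_two_cover hSfin Set.inter_subset_right Set.inter_subset_right
    Set.inter_subset_right Set.inter_subset_right hcov
  have c1 := hai hP₁T (Set.subset_union_left.trans (Set.subset_union_left.trans Set.subset_union_left)) hT₁.2 (hfinT hT₁.1)
  have c2 := hai hP₂T (Set.subset_union_right.trans (Set.subset_union_left.trans Set.subset_union_left)) hT₂.2 (hfinT hT₂.1)
  have c3 := hai hP₃T (Set.subset_union_right.trans Set.subset_union_left) hT₃.2 (hfinT hT₃.1)
  have c4 := hai hP₄T Set.subset_union_right hT₄.2 (hfinT hT₄.1)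
  have hw2 : 2 * W.ncard ≤ 12 + (P₁.ncard + P₂.ncard + P₃.ncard + P₄.ncard) := by omega
  have e : (M.E \ W).ncard = 20 - W.ncard := by omega
  rw [e] at a1 a2 a3 a4 hA₀ f1 f2 f3 f4
  have hx := S2.four_tri_bound Top.ncard W.ncard P₁.ncard P₂.ncard P₃.ncard P₄.ncard hw5 hw12 hp₁ hp₂ hp₃ hp₄ hsle hw2
    (by omega)
  exact hx

end S2

end PercRepro
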